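import Mathlib.Combinatorics.SetFamily.Compression.Down
import Mathlib.Tactic
import HarnessLib
import HarnessLib.Audit.Tags
import Summits.CriticalPhenomena.PercolationContinuityZ3.Theorems.PercNearOneGluingNoHeavyLowerTailSahiRainbowStrict
import Summits.CriticalPhenomena.PercolationContinuityZ3.Theorems.PercNearOneGluingNoHeavyLowerTailSahiRainbowAbsorption

/-!
# The strict rainbow lemma, IV: pinned points without doubled members and with PURE near-complementary pairs

Support file (seat `prim-masterthm-p1`, gen 40; `--supports stmt-CriticalPhenomena-4575`).  One typed statement (`PinnedResidualMixed`, a narrower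
residual) and pure theorems over `…SahiRainbowStrict`; no `sorry`, standard axioms.  Memo
`run/shared/lean/prim/prim-masterthm/FROM-prim-masterthm-p1-g40-STRICT-RAINBOW.md` §3–§4.

SETTING (`…SahiRainbowStrictDefs/Compress/Strict`): `𝒜 ⊆ 2^F` complement-free, `r ∈ F`, `𝔅 = 𝒜.memberSubfamily r ∪ 𝒜.nonMemberSubfamily r`,
`𝔄 = 𝒜.memberSubfamily r ∩ 𝒜.nonMemberSubfamily r`; `r` is PINNED when `𝔅` contains a complementary pair `{u, (F.erase r) \ u}`; such a pair lifts
to exactly one near-complementary pair of `𝒜`, of TYPE C0 (`u, (F.erase r) \ u ∈ 𝒜`, both `r`-free: both in the non-member subfamily) or of TYPE C1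
(`insert r u, insert r ((F.erase r) \ u) ∈ 𝒜`: both in the member subfamily).

NEW HERE ([this work], gen 40).
* `inter_mem_twins_of_pure₀` / `…₁`, `sdiff_union_mem_twins_of_pure₀` / `…₁`: the meet and the complemented join of two members of DIFFERENT pure
  pairs of the same type are TWINS (both lifts are rainbow meets of `𝒜`).
* `card_le_card_rainbowMeets_of_pinned_pure` — **the pinned step without doubled members and with all pairs of one type**: if
  `RainbowStrictOn (F.erase r)`, `𝔄 = ∅`, and every complementary pair of `𝔅` is of type C0 (resp. every one of type C1), then
  `#𝒜 ≤ #rainbowMeets F 𝒜`.  Proof: fix `y ∈ F.erase r`; `U` = the endpoints containing `y` (one per pair, complement-free), `𝔅⁻ = 𝔅 \ U`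
  (complement-free); every colour of `U` is a twin, so the master count gives `#rainbowMeets ≥ #R'(𝔅⁻) + #R'(U) ≥ #𝔅⁻ + #U = #𝒜`.
* `PinnedResidualMixed` (typed, narrower than `PinnedResidual`): the residual statement restricted to degenerate families such that at EVERY point
  `r` the point is pinned AND (there is a doubled member, or pinned pairs of both types occur); `rainbowStrict_of_pinnedResidualMixed`,
  `rainbowMeetCojoin_of_pinnedResidualMixed`.
HONEST FRAMING: `RainbowMeetCojoin`, `RainbowStrict`, `PinnedResidual(Mixed)` remain OPEN; these are unconditional reductions. [this work]
-/

namespace Summit.CriticalPhenomena.PercolationContinuityZ3.Theorems.SahiColouredDaykin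

open Finset

variable {α : Type*} [DecidableEq α]

section Pure

variable {F : Finset α} {𝒜 : Finset (Finset α)} {r : α}

/-- `insert r` of a meet of two sets avoiding... (set identity): `insert r (u ∩ u') = F \ ((F.erase r) \ u ∪ (F.erase r) \ u')` for
`u, u' ⊆ F.erase r`, `r ∈ F`. [this work] -/
theorem insert_inter_eq_sdiff_union_compl (hr : r ∈ F) {u u' : Finset α} (hu : u ⊆ F.erase r) (hu' : u' ⊆ F.erase r) :
    insert r (u ∩ u') = F \ ((F.erase r) \ u ∪ (F.erase r) \ u') := by
  ext t
  simp only [mem_insert, mem_inter, mem_sdiff, mem_union, mem_erase]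
  constructor
  · rintro (rfl | ⟨h1, h2⟩)
    · exact ⟨hr, fun h => h.elim (fun h => h.1.1 rfl) (fun h => h.1.1 rfl)⟩
    · refine ⟨(mem_erase.1 (hu h1)).2, fun h => h.elim (fun h => h.2 h1) (fun h => h.2 h2)⟩
  · rintro ⟨htF, h⟩
    by_cases htr : t = r
    · exact Or.inl htr
    · right
      exact ⟨by_contra fun h1 => h (Or.inl ⟨⟨htr, htF⟩, h1⟩), by_contra fun h2 => h (Or.inr ⟨⟨htr, htF⟩, h2⟩)⟩

/-- The complemented join of two sets inside `F.erase r` is the meet of their complements there. [this work] -/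
theorem erase_sdiff_union_eq_inter_compl {u u' : Finset α} :
    (F.erase r) \ (u ∪ u') = ((F.erase r) \ u) ∩ ((F.erase r) \ u') := by
  ext t; simp only [mem_sdiff, mem_union, mem_inter]; tauto

/-- `F \ (u ∪ u') = insert r ((F.erase r) \ (u ∪ u'))` for `u, u' ⊆ F.erase r`, `r ∈ F`. [this work] -/
theorem sdiff_union_eq_insert_erase_sdiff (hr : r ∈ F) {u u' : Finset α} (hu : u ⊆ F.erase r) (hu' : u' ⊆ F.erase r) :
    F \ (u ∪ u') = insert r ((F.erase r) \ (u ∪ u')) := by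
  ext t
  simp only [mem_sdiff, mem_union, mem_insert, mem_erase]
  constructor
  · rintro ⟨htF, h⟩
    by_cases htr : t = r
    · exact Or.inl htr
    · exact Or.inr ⟨⟨htr, htF⟩, h⟩
  · rintro (rfl | ⟨⟨_, htF⟩, h⟩)
    · exact ⟨hr, fun h => h.elim (fun h => (mem_erase.1 (hu h)).1 rfl) (fun h => (mem_erase.1 (hu' h)).1 rfl)⟩
    · exact ⟨htF, h⟩

/-- `F \ (insert r u ∪ insert r u') = (F.erase r) \ (u ∪ u')`. [this work] -/
theorem sdiff_union_insert_eq {u u' : Finset α} :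
    F \ (insert r u ∪ insert r u') = (F.erase r) \ (u ∪ u') := by
  ext t; simp only [mem_sdiff, mem_union, mem_insert, mem_erase]; tauto

/-- `insert r u ∩ insert r u' = insert r (u ∩ u')`. [this work] -/
theorem insert_inter_insert_eq {u u' : Finset α} : insert r u ∩ insert r u' = insert r (u ∩ u') := by
  ext t; simp only [mem_inter, mem_insert]; tauto

/-- **Twins from two pure C0 pairs.**  If `u, (F.erase r) \ u, u', (F.erase r) \ u'` are four members of `𝒜` (all avoiding `r`; `u ≠ u'`,
`u ≠ (F.erase r) \ u'`), then `u ∩ u'` and `(F.erase r) \ (u ∪ u')` are twins. [this work] -/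
theorem mem_twins_of_pure₀ (hr : r ∈ F) {u u' : Finset α} (hu : u ⊆ F.erase r) (hu' : u' ⊆ F.erase r)
    (h1 : u ∈ 𝒜) (h2 : (F.erase r) \ u ∈ 𝒜) (h3 : u' ∈ 𝒜) (h4 : (F.erase r) \ u' ∈ 𝒜) (hne : u ≠ u') (hne' : u ≠ (F.erase r) \ u') :
    u ∩ u' ∈ (rainbowMeets F 𝒜).memberSubfamily r ∩ (rainbowMeets F 𝒜).nonMemberSubfamily r ∧
      (F.erase r) \ (u ∪ u') ∈ (rainbowMeets F 𝒜).memberSubfamily r ∩ (rainbowMeets F 𝒜).nonMemberSubfamily r := by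
  have hru : r ∉ u := fun h => (mem_erase.1 (hu h)).1 rfl
  have hcne : (F.erase r) \ u ≠ (F.erase r) \ u' := by
    intro h; apply hne
    rw [← Finset.sdiff_sdiff_eq_self hu, h, Finset.sdiff_sdiff_eq_self hu']
  have hcne' : (F.erase r) \ u ≠ u' := by
    intro h; apply hne'; rw [← h, Finset.sdiff_sdiff_eq_self hu]
  constructor
  · have hrW : r ∉ u ∩ u' := fun h => hru (mem_inter.1 h).1
    refine mem_inter.2 ⟨mem_memberSubfamily.2 ⟨?_, hrW⟩, mem_nonMemberSubfamily.2 ⟨inter_mem_rainbowMeets h1 h3 hne, hrW⟩⟩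
    rw [insert_inter_eq_sdiff_union_compl hr hu hu']
    exact sdiff_union_mem_rainbowMeets h2 h4 hcne
  · have hrW : r ∉ (F.erase r) \ (u ∪ u') := fun h => (notMem_erase r F) (mem_sdiff.1 h).1
    refine mem_inter.2 ⟨mem_memberSubfamily.2 ⟨?_, hrW⟩, mem_nonMemberSubfamily.2 ⟨?_, hrW⟩⟩
    · rw [← sdiff_union_eq_insert_erase_sdiff hr hu hu']
      exact sdiff_union_mem_rainbowMeets h1 h3 hne
    · rw [erase_sdiff_union_eq_inter_compl]
      exact inter_mem_rainbowMeets h2 h4 hcne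

/-- **Twins from two pure C1 pairs.**  If `insert r u, insert r ((F.erase r) \ u), insert r u', insert r ((F.erase r) \ u')` are members of
`𝒜` (`u, u' ⊆ F.erase r`, `u ≠ u'`), then `u ∩ u'` and `(F.erase r) \ (u ∪ u')` are twins. [this work] -/
theorem mem_twins_of_pure₁ {u u' : Finset α} (hu : u ⊆ F.erase r) (hu' : u' ⊆ F.erase r)
    (h1 : insert r u ∈ 𝒜) (h2 : insert r ((F.erase r) \ u) ∈ 𝒜) (h3 : insert r u' ∈ 𝒜) (h4 : insert r ((F.erase r) \ u') ∈ 𝒜)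
    (hne : u ≠ u') :
    u ∩ u' ∈ (rainbowMeets F 𝒜).memberSubfamily r ∩ (rainbowMeets F 𝒜).nonMemberSubfamily r ∧
      (F.erase r) \ (u ∪ u') ∈ (rainbowMeets F 𝒜).memberSubfamily r ∩ (rainbowMeets F 𝒜).nonMemberSubfamily r := by
  have hru : r ∉ u := fun h => (mem_erase.1 (hu h)).1 rfl
  have hruc : r ∉ (F.erase r) \ u := fun h => (notMem_erase r F) (mem_sdiff.1 h).1
  have hruc' : r ∉ (F.erase r) \ u' := fun h => (notMem_erase r F) (mem_sdiff.1 h).1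
  have hru' : r ∉ u' := fun h => (mem_erase.1 (hu' h)).1 rfl
  have ins_ne : ∀ {a b : Finset α}, r ∉ a → r ∉ b → a ≠ b → insert r a ≠ insert r b := by
    intro a b ha hb hab h; apply hab; rw [← erase_insert ha, ← erase_insert hb, h]
  have hcne : (F.erase r) \ u ≠ (F.erase r) \ u' := by
    intro h; apply hne
    rw [← Finset.sdiff_sdiff_eq_self hu, h, Finset.sdiff_sdiff_eq_self hu']
  have hcsub : (F.erase r) \ u ⊆ F.erase r := sdiff_subset
  have hcsub' : (F.erase r) \ u' ⊆ F.erase r := sdiff_subset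
  constructor
  · have hrW : r ∉ u ∩ u' := fun h => hru (mem_inter.1 h).1
    refine mem_inter.2 ⟨mem_memberSubfamily.2 ⟨?_, hrW⟩, mem_nonMemberSubfamily.2 ⟨?_, hrW⟩⟩
    · rw [← insert_inter_insert_eq]
      exact inter_mem_rainbowMeets h1 h3 (ins_ne hru hru' hne)
    · -- `u ∩ u' = F \ (insert r (F'\u) ∪ insert r (F'\u'))`
      have e : u ∩ u' = F \ (insert r ((F.erase r) \ u) ∪ insert r ((F.erase r) \ u')) := by
        rw [sdiff_union_insert_eq, erase_sdiff_union_eq_inter_compl, Finset.sdiff_sdiff_eq_self hu, Finset.sdiff_sdiff_eq_self hu']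
      rw [e]; exact sdiff_union_mem_rainbowMeets h2 h4 (ins_ne hruc hruc' hcne)
  · have hrW : r ∉ (F.erase r) \ (u ∪ u') := fun h => (notMem_erase r F) (mem_sdiff.1 h).1
    refine mem_inter.2 ⟨mem_memberSubfamily.2 ⟨?_, hrW⟩, mem_nonMemberSubfamily.2 ⟨?_, hrW⟩⟩
    · -- `insert r (F' \ (u ∪ u')) = insert r (F'\u) ∩ insert r (F'\u')`
      rw [erase_sdiff_union_eq_inter_compl, ← insert_inter_insert_eq]
      exact inter_mem_rainbowMeets h2 h4 (ins_ne hruc hruc' hcne)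
    · rw [← sdiff_union_insert_eq]
      exact sdiff_union_mem_rainbowMeets h1 h3 (ins_ne hru hru' hne)

/-- **The pinned step without doubled members and with PURE pairs of one type.**  Let `𝒜 ⊆ 2^F` be complement-free with at least two members,
`r ∈ F`, no doubled member at `r` (`𝔄 = ∅`), and suppose every complementary pair of the projected family `𝔅` consists of two members of `𝒜`
avoiding `r` (type C0) — or every one consists of two projections of members containing `r` (type C1).  If the strengthened rainbow statement
holds inside `F.erase r`, then `#𝒜 ≤ #rainbowMeets F 𝒜`.  (Fix `y ∈ F.erase r`; the endpoints containing `y` form a complement-free family `U`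
all of whose colours are twins, the other members a complement-free family `B`; the master count gives `#R'(B) + #R'(U) ≤ #rainbowMeets F 𝒜`.)
[this work] -/
theorem card_le_card_rainbowMeets_of_pinned_pure (hr : r ∈ F) (h𝒜F : ∀ a ∈ 𝒜, a ⊆ F) (hcf : ∀ a ∈ 𝒜, F \ a ∉ 𝒜) (h2 : 2 ≤ #𝒜)
    (hQ : 𝒜.memberSubfamily r ∩ 𝒜.nonMemberSubfamily r = ∅)
    (hpure : (∀ b ∈ 𝒜.memberSubfamily r ∪ 𝒜.nonMemberSubfamily r, (F.erase r) \ b ∈ 𝒜.memberSubfamily r ∪ 𝒜.nonMemberSubfamily r →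
        b ∈ 𝒜.nonMemberSubfamily r ∧ (F.erase r) \ b ∈ 𝒜.nonMemberSubfamily r) ∨
      (∀ b ∈ 𝒜.memberSubfamily r ∪ 𝒜.nonMemberSubfamily r, (F.erase r) \ b ∈ 𝒜.memberSubfamily r ∪ 𝒜.nonMemberSubfamily r →
        b ∈ 𝒜.memberSubfamily r ∧ (F.erase r) \ b ∈ 𝒜.memberSubfamily r))
    (IH : RainbowStrictOn (F.erase r)) : #𝒜 ≤ #(rainbowMeets F 𝒜) := by
  -- an unpinned point is the earlier theorem
  by_cases hpin : ∀ b ∈ 𝒜.memberSubfamily r ∪ 𝒜.nonMemberSubfamily r,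
      (F.erase r) \ b ∉ 𝒜.memberSubfamily r ∪ 𝒜.nonMemberSubfamily r
  · exact card_le_card_rainbowMeets_of_unpinned hr h𝒜F hcf hpin IH
  have hsing : ({r} : Finset α) ∈ rainbowMeets F 𝒜 := singleton_mem_rainbowMeets_of_pinned hr h𝒜F hcf h2 hpin
  set M := 𝒜.memberSubfamily r with hM
  set N := 𝒜.nonMemberSubfamily r with hN
  set L := rainbowMeets F 𝒜 with hL
  obtain ⟨y, hy⟩ := erase_nonempty_of_two_le_card hr h𝒜F hcf h2
  have hsum : #(M ∪ N) + #(M ∩ N) = #𝒜 := card_compress_add_card_doubled 𝒜 r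
  have hk0 : #(M ∩ N) = 0 := by rw [hQ]; rfl
  have h𝔅F : ∀ b ∈ M ∪ N, b ⊆ F.erase r := fun b hb => subset_erase_of_mem_compress h𝒜F hb
  have hcc : ∀ {b : Finset α}, b ⊆ F.erase r → (F.erase r) \ ((F.erase r) \ b) = b := fun hb => Finset.sdiff_sdiff_eq_self hb
  -- the chosen endpoints `U` (those containing `y`) and the rest `B`
  set U := (M ∪ N).filter (fun b => (F.erase r) \ b ∈ M ∪ N ∧ y ∈ b) with hU
  set B := (M ∪ N).filter (fun b => ¬ ((F.erase r) \ b ∈ M ∪ N ∧ y ∈ b)) with hB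
  have hUB : #U + #B = #(M ∪ N) := by
    rw [hU, hB]; exact card_filter_add_card_filter_not _
  have hUF : ∀ b ∈ U, b ⊆ F.erase r := fun b hb => h𝔅F b (mem_filter.1 hb).1
  have hBF : ∀ b ∈ B, b ⊆ F.erase r := fun b hb => h𝔅F b (mem_filter.1 hb).1
  have hBcf : ∀ b ∈ B, (F.erase r) \ b ∉ B := by
    intro b hb hb'
    obtain ⟨hb1, hb2⟩ := mem_filter.1 hb
    obtain ⟨hb1', hb2'⟩ := mem_filter.1 hb'
    have hyb : y ∉ b := fun h => hb2 ⟨hb1', h⟩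
    have hyb' : y ∉ (F.erase r) \ b := fun h => hb2' ⟨by rw [hcc (h𝔅F b hb1)]; exact hb1, h⟩
    exact hyb' (mem_sdiff.2 ⟨hy, hyb⟩)
  have hUcf : ∀ b ∈ U, (F.erase r) \ b ∉ U := by
    intro b hb hb'
    exact (mem_sdiff.1 (mem_filter.1 hb').2.2).2 (mem_filter.1 hb).2.2
  -- every colour of `U` is a twin
  have hUtw : rainbowMeets (F.erase r) U ⊆ L.memberSubfamily r ∩ L.nonMemberSubfamily r := by
    intro Z hZ
    rcases mem_rainbowMeets_iff.1 hZ with rfl | ⟨u, hu, u', hu', hne, hZ⟩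
    · exact empty_mem_twins_of_singleton_mem F 𝒜 r hsing
    obtain ⟨huMN, huc, hyu⟩ := mem_filter.1 hu
    obtain ⟨hu'MN, hu'c, hyu'⟩ := mem_filter.1 hu'
    have hne' : u ≠ (F.erase r) \ u' := fun h => (mem_sdiff.1 (h ▸ hyu)).2 hyu'
    have huF := h𝔅F u huMN
    have hu'F := h𝔅F u' hu'MN
    rcases hpure with hp | hp
    · obtain ⟨a1, a2⟩ := hp u huMN huc
      obtain ⟨a3, a4⟩ := hp u' hu'MN hu'c
      have tw := mem_twins_of_pure₀ (𝒜 := 𝒜) hr huF hu'F (mem_nonMemberSubfamily.1 a1).1 (mem_nonMemberSubfamily.1 a2).1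
        (mem_nonMemberSubfamily.1 a3).1 (mem_nonMemberSubfamily.1 a4).1 hne hne'
      rcases hZ with rfl | rfl
      · exact tw.1
      · exact tw.2
    · obtain ⟨a1, a2⟩ := hp u huMN huc
      obtain ⟨a3, a4⟩ := hp u' hu'MN hu'c
      have tw := mem_twins_of_pure₁ (𝒜 := 𝒜) huF hu'F (mem_memberSubfamily.1 a1).1 (mem_memberSubfamily.1 a2).1
        (mem_memberSubfamily.1 a3).1 (mem_memberSubfamily.1 a4).1 hne
      rcases hZ with rfl | rfl
      · exact tw.1
      · exact tw.2
  -- counting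
  have c1 := card_compress_add_card_twins_le F 𝒜 r (rainbowMeets (F.erase r) U) hUtw
  rw [← hM, ← hN, ← hL] at c1
  have hBsub : B ⊆ M ∪ N := filter_subset _ _
  have cB := card_le_card (rainbowMeets_mono (F.erase r) hBsub)
  have IHB := (IH B hBF hBcf).1
  have IHU := (IH U hUF hUcf).1
  omega

end Pure

/-! ### The narrower residual -/

/-- **The MIXED residual (typed).**  The residual statement restricted further: degenerate complement-free families such that at EVERY point
`r ∈ F` the point is pinned and, moreover, there is a doubled member at `r` or the near-complementary pairs at `r` are not all of one pure type.
By `rainbowStrict_of_pinnedResidualMixed` this is all that is missing for `RainbowMeetCojoin`. [this work] [status: open] -/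
@[conjecture] def PinnedResidualMixed (α : Type*) [DecidableEq α] : Prop :=
  ∀ (F : Finset α) (𝒜 : Finset (Finset α)), (∀ a ∈ 𝒜, a ⊆ F) → (∀ a ∈ 𝒜, F \ a ∉ 𝒜) → RainbowDegenerate F 𝒜 →
    (∀ r ∈ F, ¬ ∀ b ∈ 𝒜.memberSubfamily r ∪ 𝒜.nonMemberSubfamily r,
      (F.erase r) \ b ∉ 𝒜.memberSubfamily r ∪ 𝒜.nonMemberSubfamily r) →
    (∀ r ∈ F, 𝒜.memberSubfamily r ∩ 𝒜.nonMemberSubfamily r = ∅ →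
      ¬ ((∀ b ∈ 𝒜.memberSubfamily r ∪ 𝒜.nonMemberSubfamily r, (F.erase r) \ b ∈ 𝒜.memberSubfamily r ∪ 𝒜.nonMemberSubfamily r →
            b ∈ 𝒜.nonMemberSubfamily r ∧ (F.erase r) \ b ∈ 𝒜.nonMemberSubfamily r) ∨
         (∀ b ∈ 𝒜.memberSubfamily r ∪ 𝒜.nonMemberSubfamily r, (F.erase r) \ b ∈ 𝒜.memberSubfamily r ∪ 𝒜.nonMemberSubfamily r →
            b ∈ 𝒜.memberSubfamily r ∧ (F.erase r) \ b ∈ 𝒜.memberSubfamily r))) →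
    (∀ r ∈ F, RainbowStrictOn (F.erase r)) → #𝒜 ≤ #(rainbowMeets F 𝒜)

/-- The mixed residual implies the residual statement of `…SahiRainbowStrictDefs`. [this work] -/
theorem pinnedResidual_of_pinnedResidualMixed (h : PinnedResidualMixed α) : PinnedResidual α := by
  intro F 𝒜 h𝒜F hcf hdeg hpin IH
  by_cases hmix : ∀ r ∈ F, 𝒜.memberSubfamily r ∩ 𝒜.nonMemberSubfamily r = ∅ →
      ¬ ((∀ b ∈ 𝒜.memberSubfamily r ∪ 𝒜.nonMemberSubfamily r, (F.erase r) \ b ∈ 𝒜.memberSubfamily r ∪ 𝒜.nonMemberSubfamily r →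
            b ∈ 𝒜.nonMemberSubfamily r ∧ (F.erase r) \ b ∈ 𝒜.nonMemberSubfamily r) ∨
         (∀ b ∈ 𝒜.memberSubfamily r ∪ 𝒜.nonMemberSubfamily r, (F.erase r) \ b ∈ 𝒜.memberSubfamily r ∪ 𝒜.nonMemberSubfamily r →
            b ∈ 𝒜.memberSubfamily r ∧ (F.erase r) \ b ∈ 𝒜.memberSubfamily r))
  · exact h F 𝒜 h𝒜F hcf hdeg hpin hmix IH
  · push Not at hmix
    obtain ⟨r, hr, hQ, hpure⟩ := hmix
    have h2 : 2 ≤ #𝒜 := by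
      obtain ⟨a, ha, b, hb, hab, _⟩ := degenerate_iff.1 hdeg
      exact one_lt_card.2 ⟨a, ha, b, hb, hab⟩
    exact card_le_card_rainbowMeets_of_pinned_pure hr h𝒜F hcf h2 hQ hpure (IH r hr)

/-- **The strict rainbow lemma follows from the mixed residual.** [this work] -/
theorem rainbowStrict_of_pinnedResidualMixed (h : PinnedResidualMixed α) : RainbowStrict α :=
  rainbowStrict_of_pinnedResidual (pinnedResidual_of_pinnedResidualMixed h)

/-- **The rainbow lemma follows from the mixed residual.** [this work] -/
theorem rainbowMeetCojoin_of_pinnedResidualMixed (h : PinnedResidualMixed α) : RainbowMeetCojoin α :=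
  rainbowMeetCojoin_of_pinnedResidual (pinnedResidual_of_pinnedResidualMixed h)

end Summit.CriticalPhenomena.PercolationContinuityZ3.Theorems.SahiColouredDaykin
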